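import Literature.Topology.CoveringSpaces.CoveringGaloisCorrespondenceEquivalence
import Literature.AnabelianGeometry.Anabelioids.FiniteActionFundamentalGroup
import Mathlib.Topology.Algebra.ContinuousMonoidHom
import HarnessLib

/-!
# `π₁(Cov^fin(X), fibre at x₀) = π̂₁(X, x₀)`: the fundamental group of the Galois category of finite
# covering spaces is the profinite completion of the topological fundamental group

PROOF-ONLY companion (abc-iut cell, campaign-L R1, GAP row G-L4t14-R1 support; seat abc-iut-f-072).  The
basepoint form of abc-iut-w5-d144's junction «`Cov^fin(X) ≌ B(π̂₁(X, x₀))`» (`CovFin.galoisCorrespondence`,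
Hatcher Thm. 1.38, composed with `FiniteActionCompletion.equivalence`): for `X` path connected and strongly
locally contractible and `x₀ ∈ X`, the automorphism group of the fibre functor `E ↦ p_E⁻¹(x₀)` of
`Cov^fin(X)` — its `π₁` at the basepoint `x₀` in the sense of [GeoAn] Def. 1.1.2 (ii) / [SGA1] V §4 — is
canonically isomorphic, as a TOPOLOGICAL group, to the PROFINITE COMPLETION of `π₁(X, x₀)`, the dense image
of `π₁(X, x₀)` acting on every fibre by MONODROMY:

* `CovFin.exists_continuousMulEquiv_aut_fibreFunctor x₀ :
    ∃ e : π̂₁(X,x₀) ≃ₜ* Aut (fibreFunctor x₀ ⋙ forget), ∀ γ E y, (e (η γ))_E y = monodromy γ y`.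

This is the topological counterpart of [SGA1] Exp. XII Cor. 5.2 («`π₁^ét = (π₁^top)^∧`») and of [SemiAnbd]
Prop. 3.6 (iii) p. 38; it is what [AbsTopIII] §4 (Lemma 4.3) calls `Π_𝕏` for an object `𝕏` of the
archimedean `EA`, read at the level of `Cov^fin`.  No definition, no named fact; nothing here bears on
[IUTchIII] Cor. 3.12.
-/

noncomputable section

open CategoryTheory CategoryTheory.PreGaloisCategory

universe u

namespace Literature.Topology.CoveringSpaces.CovFin

open Literature.AnabelianGeometry.Anabelioids Literature.IUT.HodgeTheaters

variable {X : Type u} [TopologicalSpace X] [PathConnectedSpace X] [StronglyLocallyContractibleSpace X]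

/-- The functor of the finite Galois correspondence followed by the forgetful functor IS the fibre functor
with the action forgotten (definitionally). [cite: HatcherAT2002, §1.3 Thm. 1.38] -/
theorem galoisCorrespondence_functor_comp_forget (x₀ : X) :
    (galoisCorrespondence (X := X) x₀).functor ⋙ Action.forget FintypeCat.{u} (FundamentalGroup X x₀) =
      fibreFunctor x₀ ⋙ Action.forget FintypeCat.{u} (FundamentalGroup X x₀) := rfl

/-- **`π₁(Cov^fin(X), x₀) = π̂₁(X, x₀)`**: there is an isomorphism of topological groups from the profinite
completion of `π₁(X, x₀)` onto the automorphism group of the fibre functor `E ↦ p_E⁻¹(x₀)` of `Cov^fin(X)`,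
under which the image `η(γ)` of a loop class `γ` acts on every fibre by the monodromy of `γ` (which pins
the isomorphism down, `η` having dense image). [cite: SGA1, Exp. V §5] -/
theorem exists_continuousMulEquiv_aut_fibreFunctor (x₀ : X) :
    ∃ e : profiniteCompletion (FundamentalGroup X x₀) ≃ₜ*
        Aut (fibreFunctor x₀ ⋙ Action.forget FintypeCat.{u} (FundamentalGroup X x₀)),
      ∀ (γ : FundamentalGroup X x₀) (E : CovFin X) (y : E.proj ⁻¹' {x₀}),
        ((e (toCompletion _ γ)).hom.app E).hom y = E.property.1.monodromy γ y := by
  obtain ⟨e₁, he₁⟩ := exists_continuousMulEquiv_aut_forget_action.{u} (FundamentalGroup X x₀)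
  -- transport of the basepoint along `Cov^fin(X) ≌ Action FintypeCat π₁` (whiskering by the equivalence)
  let eqv := galoisCorrespondence (X := X) x₀
  let F := Action.forget FintypeCat.{u} (FundamentalGroup X x₀)
  let φ : Aut F ≃* Aut (eqv.functor ⋙ F) :=
    (eqv.symm.congrLeft (E := FintypeCat.{u})).fullyFaithfulFunctor.autMulEquivOfFullyFaithful F
  have hφ : ∀ (σ : Aut F) (E : CovFin X), (φ σ).hom.app E = σ.hom.app (eqv.functor.obj E) :=
    fun _ _ => rfl
  have hφc : Continuous φ := by
    rw [(autEmbedding_isClosedEmbedding _).isInducing.continuous_iff, continuous_pi_iff]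
    intro E
    change Continuous fun a ↦ autEmbedding F a (eqv.functor.obj E)
    fun_prop
  let e₂ : Aut F ≃ₜ* Aut (eqv.functor ⋙ F) :=
    { φ with
      continuous_toFun := hφc
      continuous_invFun := Continuous.continuous_symm_of_equiv_compact_to_t2 (f := φ.toEquiv) hφc }
  refine ⟨e₁.trans e₂, fun γ E y => ?_⟩
  change ((φ (e₁ (toCompletion _ γ))).hom.app E).hom y = _
  rw [hφ, he₁]
  rfl

end Literature.Topology.CoveringSpaces.CovFin
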